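import Summits.Ventures.PercRepro.RankLevelSetLevelSixHeavyCellSq38T
import Summits.Ventures.PercRepro.RankLevelSetLevelSixArithHeavySq38TA
import Summits.Ventures.PercRepro.RankLevelSetLevelSixArithHeavySq38TB
import Summits.Ventures.PercRepro.RankLevelSetLevelSixArithHeavySq38TC
import Summits.Ventures.PercRepro.RankLevelSetLevelSixArithHeavySq38TD
import Summits.Ventures.PercRepro.RankLevelSetLevelSixArithHeavySq38TE
import Summits.Ventures.PercRepro.RankLevelSetLevelSixArithHeavySq38TF
import Summits.Ventures.PercRepro.RankLevelSetLevelSixArithHeavySq38TG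
import Summits.Ventures.PercRepro.RankLevelSetLevelSixArithHeavySq38TH
import Summits.Ventures.PercRepro.RankLevelSetLevelSixArithHeavySq38TI
import Summits.Ventures.PercRepro.S3SixWindow
import Summits.Ventures.PercRepro.RankLevelSetCoreSixLowSelf
import Summits.Ventures.PercRepro.RankLevelSetLevelFivePart

/-!
# PercRepro — THEOREM C₆ ON THE FLAT BOUNDS `f(6) ≤ 39`, `f(5) ≤ 19`, LEMMAS T⁺⁺ AND T4⁺, THE FLAT-COUNT TAIL AND THE UNIQUE
HEAVY FLAT: LEVEL `5` AT `37` ⇒ C-025 AT LEVEL `6` FOR EVERY `p ≥ 38`, AND `c025_six_large_thirty_eight (38 ≤ p) : RLS M p 6`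
UNCONDITIONAL (p8 g3, S3)

`proofs/SUBCLAIM-S3-p8.md` §3l. The 39 chain of §3k (`c025_six_large_thirty_nine`) with p1's LEMMA T4⁺ (`4·s₄ ≤ d(d+1)(d+2)`,
`S1.four_mul_ncard_fourCircuits_le`, S1CoreFourCircuitSum) in place of LEMMA T4 — the cells `d = 8, 9` that stop the
unique-flat chain at `38`; the levers otherwise as in §3k: THE UNIQUE HEAVY FLAT (RankLevelSetDepCountHeavyU:
when `2ν₁ ≥ d + 15` two heavy rank-`6` flats would meet in a rank-`≤ 5` set of nullity `> 14`, so `|UG| ≤ min(39, 6 + d)` in place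
of the union bound `6 + (j + 1)d − jν₁` — `2^{39}` against `2^{55}` at `(39, 41)`); the other levers as in §3i: p1's LEMMA T⁺⁺
(`s₃ ≤ (d² − 3d + 8)/2`, S1TrianglePlusPlus) and the FLAT-COUNT TAIL (the rank-`≤ 6` sets `≤ Σ_{j ≤ 19} C(n, j) +
2^{33}·Σ_{j ≤ 6} C(n, j)`, coranks 23 … 50). Every core cell `(p, 7 ≤ d ≤ 50)` at `p ≥ 38` by the split cell
`c025_core_six_heavy_cell_sq39u` (the unique flat from `d = 30`; no heavy-free cell is needed), with the per-corank parameters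
of RankLevelSetLevelSixArithHeavySq38TA … I (`c025_core_six_bounded_corank_heavy_sq38t`); the cells `d ≥ 51` by `c025_core_six_thirtynine_thirtyeight'`
(`38 ≤ p`, RankLevelSetCoreSixLowSelf); level `5` for `p ≥ 37` gives level `6` for `p ≥ 38` (`c025_six_of_five_heavy_sq38t`: rank `38` by
`rls_six_at_of_core`, ranks `≥ 39` by `rls_succ_large`). On p7's `c025_five_large_part33 (33 ≤ p)` (RankLevelSetLevelFivePart)
this is **`c025_six_large_thirty_eight (38 ≤ p)`**, unconditional over the tree. At `37` the cell `d = 8` fails (the `s₃` bound: LEMMA T⁺⁺'s `24` against the true cap `13`, p3's lane).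
Axioms: standard.
-/

open scoped Matroid

namespace PercRepro

namespace ThmN

open Set

variable {α : Type}

/-- **The `e`-free core at level `6`, corank `7 ≤ d ≤ 50`, rank `p ≥ 38`** (flat bounds `39 / 19`, LEMMA T⁺⁺, square
multiplicity, rational tails in the nullity-cap or the flat-count form, the unique heavy flat from `d = 30`, LEMMA T4⁺). -/
theorem c025_core_six_bounded_corank_heavy_sq38t (M : Matroid α) [M.Finite] (p d : ℕ) (hp : 38 ≤ p) (hd7 : 7 ≤ d)
    (hd50 : d ≤ 50) (hR : M.eRank = (p : ℕ∞)) (hn : M.E.ncard = p + d)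
    (hfree : ∀ e ∈ M.E, ∃ A ⊆ M.E \ {e}, e ∉ M.closure A ∧ e ∉ M.closure ((M.E \ {e}) \ A)) :
    RLS M p 6 := by
  interval_cases d
  · exact c025_core_six_heavy_cell_sq38t M p 7 7 1 1 13 12 0 302482 1000 13
      (by norm_num) (by norm_num) (by norm_num) (by norm_num) (by norm_num) (by norm_num) (by norm_num)
      (by norm_num [cnull]) (by norm_num [cnull]) (Or.inl (by norm_num)) (Or.inl (by norm_num)) (Or.inl (by norm_num)) (by norm_num) (by norm_num) (by norm_num)
      (Or.inl (tail_six_heavy_sq38T_7 (p + 7) (by omega))) hR hn hfree (level_six_poly_heavy_sq38T_7 p hp)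
  · exact c025_core_six_heavy_cell_sq38t M p 8 7 2 1 16 14 0 176043 1000 14
      (by norm_num) (by norm_num) (by norm_num) (by norm_num) (by norm_num) (by norm_num) (by norm_num)
      (by norm_num [cnull]) (by norm_num [cnull]) (Or.inl (by norm_num)) (Or.inl (by norm_num)) (Or.inl (by norm_num)) (by norm_num) (by norm_num) (by norm_num)
      (Or.inl (tail_six_heavy_sq38T_8 (p + 8) (by omega))) hR hn hfree (level_six_poly_heavy_sq38T_8 p hp)
  · exact c025_core_six_heavy_cell_sq38t M p 9 7 2 1 19 16 0 107245 1000 15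
      (by norm_num) (by norm_num) (by norm_num) (by norm_num) (by norm_num) (by norm_num) (by norm_num)
      (by norm_num [cnull]) (by norm_num [cnull]) (Or.inl (by norm_num)) (Or.inl (by norm_num)) (Or.inl (by norm_num)) (by norm_num) (by norm_num) (by norm_num)
      (Or.inl (tail_six_heavy_sq38T_9 (p + 9) (by omega))) hR hn hfree (level_six_poly_heavy_sq38T_9 p hp)
  · exact c025_core_six_heavy_cell_sq38t M p 10 7 2 1 22 18 0 68104 1000 16
      (by norm_num) (by norm_num) (by norm_num) (by norm_num) (by norm_num) (by norm_num) (by norm_num)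
      (by norm_num [cnull]) (by norm_num [cnull]) (Or.inl (by norm_num)) (Or.inl (by norm_num)) (Or.inl (by norm_num)) (by norm_num) (by norm_num) (by norm_num)
      (Or.inl (tail_six_heavy_sq38T_10 (p + 10) (by omega))) hR hn hfree (level_six_poly_heavy_sq38T_10 p hp)
  · exact c025_core_six_heavy_cell_sq38t M p 11 8 2 1 23 19 0 44917 1000 17
      (by norm_num) (by norm_num) (by norm_num) (by norm_num) (by norm_num) (by norm_num) (by norm_num)
      (by norm_num [cnull]) (by norm_num [cnull]) (Or.inl (by norm_num)) (Or.inl (by norm_num)) (Or.inl (by norm_num)) (by norm_num) (by norm_num) (by norm_num)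
      (Or.inl (tail_six_heavy_sq38T_11 (p + 11) (by omega))) hR hn hfree (level_six_poly_heavy_sq38T_11 p hp)
  · exact c025_core_six_heavy_cell_sq38t M p 12 9 2 1 24 20 0 30668 1000 18
      (by norm_num) (by norm_num) (by norm_num) (by norm_num) (by norm_num) (by norm_num) (by norm_num)
      (by norm_num [cnull]) (by norm_num [cnull]) (Or.inl (by norm_num)) (Or.inl (by norm_num)) (Or.inl (by norm_num)) (by norm_num) (by norm_num) (by norm_num)
      (Or.inl (tail_six_heavy_sq38T_12 (p + 12) (by omega))) hR hn hfree (level_six_poly_heavy_sq38T_12 p hp)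
  · exact c025_core_six_heavy_cell_sq38t M p 13 10 1 1 22 18 0 21613 1000 19
      (by norm_num) (by norm_num) (by norm_num) (by norm_num) (by norm_num) (by norm_num) (by norm_num)
      (by norm_num [cnull]) (by norm_num [cnull]) (Or.inl (by norm_num)) (Or.inr (Or.inl ⟨by norm_num, by norm_num⟩)) (Or.inl (by norm_num)) (by norm_num) (by norm_num) (by norm_num)
      (Or.inl (tail_six_heavy_sq38T_13 (p + 13) (by omega))) hR hn hfree (level_six_poly_heavy_sq38T_13 p hp)
  · exact c025_core_six_heavy_cell_sq38t M p 14 11 1 1 23 19 0 15681 1000 20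
      (by norm_num) (by norm_num) (by norm_num) (by norm_num) (by norm_num) (by norm_num) (by norm_num)
      (by norm_num [cnull]) (by norm_num [cnull]) (Or.inl (by norm_num)) (Or.inr (Or.inl ⟨by norm_num, by norm_num⟩)) (Or.inl (by norm_num)) (by norm_num) (by norm_num) (by norm_num)
      (Or.inl (tail_six_heavy_sq38T_14 (p + 14) (by omega))) hR hn hfree (level_six_poly_heavy_sq38T_14 p hp)
  · exact c025_core_six_heavy_cell_sq38t M p 15 11 1 1 25 19 0 11684 1000 21
      (by norm_num) (by norm_num) (by norm_num) (by norm_num) (by norm_num) (by norm_num) (by norm_num)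
      (by norm_num [cnull]) (by norm_num [cnull]) (Or.inl (by norm_num)) (Or.inr (Or.inl ⟨by norm_num, by norm_num⟩)) (Or.inl (by norm_num)) (by norm_num) (by norm_num) (by norm_num)
      (Or.inl (tail_six_heavy_sq38T_15 (p + 15) (by omega))) hR hn hfree (level_six_poly_heavy_sq38T_15 p hp)
  · exact c025_core_six_heavy_cell_sq38t M p 16 12 1 1 26 19 0 8921 1000 22
      (by norm_num) (by norm_num) (by norm_num) (by norm_num) (by norm_num) (by norm_num) (by norm_num)
      (by norm_num [cnull]) (by norm_num [cnull]) (Or.inl (by norm_num)) (Or.inr (Or.inl ⟨by norm_num, by norm_num⟩)) (Or.inl (by norm_num)) (by norm_num) (by norm_num) (by norm_num)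
      (Or.inl (tail_six_heavy_sq38T_16 (p + 16) (by omega))) hR hn hfree (level_six_poly_heavy_sq38T_16 p hp)
  · exact c025_core_six_heavy_cell_sq38t M p 17 12 1 1 28 19 0 6967 1000 23
      (by norm_num) (by norm_num) (by norm_num) (by norm_num) (by norm_num) (by norm_num) (by norm_num)
      (by norm_num [cnull]) (by norm_num [cnull]) (Or.inl (by norm_num)) (Or.inr (Or.inl ⟨by norm_num, by norm_num⟩)) (Or.inl (by norm_num)) (by norm_num) (by norm_num) (by norm_num)
      (Or.inl (tail_six_heavy_sq38T_17 (p + 17) (by omega))) hR hn hfree (level_six_poly_heavy_sq38T_17 p hp)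
  · exact c025_core_six_heavy_cell_sq38t M p 18 13 1 1 29 19 0 5553 1000 24
      (by norm_num) (by norm_num) (by norm_num) (by norm_num) (by norm_num) (by norm_num) (by norm_num)
      (by norm_num [cnull]) (by norm_num [cnull]) (Or.inl (by norm_num)) (Or.inr (Or.inl ⟨by norm_num, by norm_num⟩)) (Or.inl (by norm_num)) (by norm_num) (by norm_num) (by norm_num)
      (Or.inl (tail_six_heavy_sq38T_18 (p + 18) (by omega))) hR hn hfree (level_six_poly_heavy_sq38T_18 p hp)
  · exact c025_core_six_heavy_cell_sq38t M p 19 13 1 1 31 19 0 4510 1000 25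
      (by norm_num) (by norm_num) (by norm_num) (by norm_num) (by norm_num) (by norm_num) (by norm_num)
      (by norm_num [cnull]) (by norm_num [cnull]) (Or.inl (by norm_num)) (Or.inr (Or.inl ⟨by norm_num, by norm_num⟩)) (Or.inl (by norm_num)) (by norm_num) (by norm_num) (by norm_num)
      (Or.inl (tail_six_heavy_sq38T_19 (p + 19) (by omega))) hR hn hfree (level_six_poly_heavy_sq38T_19 p hp)
  · exact c025_core_six_heavy_cell_sq38t M p 20 14 1 1 32 19 0 3727 1000 26
      (by norm_num) (by norm_num) (by norm_num) (by norm_num) (by norm_num) (by norm_num) (by norm_num)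
      (by norm_num [cnull]) (by norm_num [cnull]) (Or.inl (by norm_num)) (Or.inr (Or.inl ⟨by norm_num, by norm_num⟩)) (Or.inl (by norm_num)) (by norm_num) (by norm_num) (by norm_num)
      (Or.inl (tail_six_heavy_sq38T_20 (p + 20) (by omega))) hR hn hfree (level_six_poly_heavy_sq38T_20 p hp)
  · exact c025_core_six_heavy_cell_sq38t M p 21 14 1 1 34 19 0 3128 1000 27
      (by norm_num) (by norm_num) (by norm_num) (by norm_num) (by norm_num) (by norm_num) (by norm_num)
      (by norm_num [cnull]) (by norm_num [cnull]) (Or.inl (by norm_num)) (Or.inr (Or.inl ⟨by norm_num, by norm_num⟩)) (Or.inl (by norm_num)) (by norm_num) (by norm_num) (by norm_num)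
      (Or.inl (tail_six_heavy_sq38T_21 (p + 21) (by omega))) hR hn hfree (level_six_poly_heavy_sq38T_21 p hp)
  · exact c025_core_six_heavy_cell_sq38t M p 22 15 1 1 35 0 0 2663 1000 28
      (by norm_num) (by norm_num) (by norm_num) (by norm_num) (by norm_num) (by norm_num) (by norm_num)
      (by norm_num [cnull]) (by norm_num [cnull]) (Or.inl (by norm_num)) (Or.inr (Or.inr (by norm_num))) (Or.inl (by norm_num)) (by norm_num) (by norm_num) (by norm_num)
      (Or.inl (tail_six_heavy_sq38T_22 (p + 22) (by omega))) hR hn hfree (level_six_poly_heavy_sq38T_22 p hp)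
  · exact c025_core_six_heavy_cell_sq38t M p 23 15 1 1 37 0 0 3711 1000 29
      (by norm_num) (by norm_num) (by norm_num) (by norm_num) (by norm_num) (by norm_num) (by norm_num)
      (by norm_num [cnull]) (by norm_num [cnull]) (Or.inl (by norm_num)) (Or.inr (Or.inr (by norm_num))) (Or.inl (by norm_num)) (by norm_num) (by norm_num) (by norm_num)
      (Or.inr (tail_six_heavy_sq38T_23 (p + 23) (by omega))) hR hn hfree (level_six_poly_heavy_sq38T_23 p hp)
  · exact c025_core_six_heavy_cell_sq38t M p 24 17 1 1 37 0 1 5610 1000 30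
      (by norm_num) (by norm_num) (by norm_num) (by norm_num) (by norm_num) (by norm_num) (by norm_num)
      (by norm_num [cnull]) (by norm_num [cnull]) (Or.inl (by norm_num)) (Or.inr (Or.inr (by norm_num))) (Or.inr rfl) (by norm_num) (by norm_num) (by norm_num)
      (Or.inr (tail_six_heavy_sq38T_24 (p + 24) (by omega))) hR hn hfree (level_six_poly_heavy_sq38T_24 p hp)
  · exact c025_core_six_heavy_cell_sq38t M p 25 18 1 1 38 0 1 7326 1000 31
      (by norm_num) (by norm_num) (by norm_num) (by norm_num) (by norm_num) (by norm_num) (by norm_num)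
      (by norm_num [cnull]) (by norm_num [cnull]) (Or.inl (by norm_num)) (Or.inr (Or.inr (by norm_num))) (Or.inr rfl) (by norm_num) (by norm_num) (by norm_num)
      (Or.inr (tail_six_heavy_sq38T_25 (p + 25) (by omega))) hR hn hfree (level_six_poly_heavy_sq38T_25 p hp)
  · exact c025_core_six_heavy_cell_sq38t M p 26 18 1 1 40 0 1 8072 1000 32
      (by norm_num) (by norm_num) (by norm_num) (by norm_num) (by norm_num) (by norm_num) (by norm_num)
      (by norm_num [cnull]) (by norm_num [cnull]) (Or.inl (by norm_num)) (Or.inr (Or.inr (by norm_num))) (Or.inr rfl) (by norm_num) (by norm_num) (by norm_num)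
      (Or.inr (tail_six_heavy_sq38T_26 (p + 26) (by omega))) hR hn hfree (level_six_poly_heavy_sq38T_26 p hp)
  · exact c025_core_six_heavy_cell_sq38t M p 27 19 1 1 41 0 1 7743 1000 33
      (by norm_num) (by norm_num) (by norm_num) (by norm_num) (by norm_num) (by norm_num) (by norm_num)
      (by norm_num [cnull]) (by norm_num [cnull]) (Or.inl (by norm_num)) (Or.inr (Or.inr (by norm_num))) (Or.inr rfl) (by norm_num) (by norm_num) (by norm_num)
      (Or.inr (tail_six_heavy_sq38T_27 (p + 27) (by omega))) hR hn hfree (level_six_poly_heavy_sq38T_27 p hp)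
  · exact c025_core_six_heavy_cell_sq38t M p 28 20 1 1 42 0 1 6849 1000 34
      (by norm_num) (by norm_num) (by norm_num) (by norm_num) (by norm_num) (by norm_num) (by norm_num)
      (by norm_num [cnull]) (by norm_num [cnull]) (Or.inl (by norm_num)) (Or.inr (Or.inr (by norm_num))) (Or.inr rfl) (by norm_num) (by norm_num) (by norm_num)
      (Or.inr (tail_six_heavy_sq38T_28 (p + 28) (by omega))) hR hn hfree (level_six_poly_heavy_sq38T_28 p hp)
  · exact c025_core_six_heavy_cell_sq38t M p 29 22 1 1 35 0 1 5851 1000 35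
      (by norm_num) (by norm_num) (by norm_num) (by norm_num) (by norm_num) (by norm_num) (by norm_num)
      (by norm_num [cnull]) (by norm_num [cnull]) (Or.inr ⟨by norm_num, by norm_num⟩) (Or.inr (Or.inr (by norm_num))) (Or.inr rfl) (by norm_num) (by norm_num) (by norm_num)
      (Or.inr (tail_six_heavy_sq38T_29 (p + 29) (by omega))) hR hn hfree (level_six_poly_heavy_sq38T_29 p hp)
  · exact c025_core_six_heavy_cell_sq38t M p 30 23 1 1 36 0 1 4956 1000 36
      (by norm_num) (by norm_num) (by norm_num) (by norm_num) (by norm_num) (by norm_num) (by norm_num)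
      (by norm_num [cnull]) (by norm_num [cnull]) (Or.inr ⟨by norm_num, by norm_num⟩) (Or.inr (Or.inr (by norm_num))) (Or.inr rfl) (by norm_num) (by norm_num) (by norm_num)
      (Or.inr (tail_six_heavy_sq38T_30 (p + 30) (by omega))) hR hn hfree (level_six_poly_heavy_sq38T_30 p hp)
  · exact c025_core_six_heavy_cell_sq38t M p 31 23 1 1 37 0 1 4215 1000 37
      (by norm_num) (by norm_num) (by norm_num) (by norm_num) (by norm_num) (by norm_num) (by norm_num)
      (by norm_num [cnull]) (by norm_num [cnull]) (Or.inr ⟨by norm_num, by norm_num⟩) (Or.inr (Or.inr (by norm_num))) (Or.inr rfl) (by norm_num) (by norm_num) (by norm_num)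
      (Or.inr (tail_six_heavy_sq38T_31 (p + 31) (by omega))) hR hn hfree (level_six_poly_heavy_sq38T_31 p hp)
  · exact c025_core_six_heavy_cell_sq38t M p 32 24 1 1 38 0 1 3618 1000 38
      (by norm_num) (by norm_num) (by norm_num) (by norm_num) (by norm_num) (by norm_num) (by norm_num)
      (by norm_num [cnull]) (by norm_num [cnull]) (Or.inr ⟨by norm_num, by norm_num⟩) (Or.inr (Or.inr (by norm_num))) (Or.inr rfl) (by norm_num) (by norm_num) (by norm_num)
      (Or.inr (tail_six_heavy_sq38T_32 (p + 32) (by omega))) hR hn hfree (level_six_poly_heavy_sq38T_32 p hp)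
  · exact c025_core_six_heavy_cell_sq38t M p 33 24 1 1 39 0 1 3141 1000 39
      (by norm_num) (by norm_num) (by norm_num) (by norm_num) (by norm_num) (by norm_num) (by norm_num)
      (by norm_num [cnull]) (by norm_num [cnull]) (Or.inr ⟨by norm_num, by norm_num⟩) (Or.inr (Or.inr (by norm_num))) (Or.inr rfl) (by norm_num) (by norm_num) (by norm_num)
      (Or.inr (tail_six_heavy_sq38T_33 (p + 33) (by omega))) hR hn hfree (level_six_poly_heavy_sq38T_33 p hp)
  · exact c025_core_six_heavy_cell_sq38t M p 34 25 1 1 39 0 1 2759 1000 39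
      (by norm_num) (by norm_num) (by norm_num) (by norm_num) (by norm_num) (by norm_num) (by norm_num)
      (by norm_num [cnull]) (by norm_num [cnull]) (Or.inr ⟨by norm_num, by norm_num⟩) (Or.inr (Or.inr (by norm_num))) (Or.inr rfl) (by norm_num) (by norm_num) (by norm_num)
      (Or.inr (tail_six_heavy_sq38T_34 (p + 34) (by omega))) hR hn hfree (level_six_poly_heavy_sq38T_34 p hp)
  · exact c025_core_six_heavy_cell_sq38t M p 35 25 1 1 39 0 1 2452 1000 39
      (by norm_num) (by norm_num) (by norm_num) (by norm_num) (by norm_num) (by norm_num) (by norm_num)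
      (by norm_num [cnull]) (by norm_num [cnull]) (Or.inr ⟨by norm_num, by norm_num⟩) (Or.inr (Or.inr (by norm_num))) (Or.inr rfl) (by norm_num) (by norm_num) (by norm_num)
      (Or.inr (tail_six_heavy_sq38T_35 (p + 35) (by omega))) hR hn hfree (level_six_poly_heavy_sq38T_35 p hp)
  · exact c025_core_six_heavy_cell_sq38t M p 36 26 1 1 39 0 1 2203 1000 39
      (by norm_num) (by norm_num) (by norm_num) (by norm_num) (by norm_num) (by norm_num) (by norm_num)
      (by norm_num [cnull]) (by norm_num [cnull]) (Or.inr ⟨by norm_num, by norm_num⟩) (Or.inr (Or.inr (by norm_num))) (Or.inr rfl) (by norm_num) (by norm_num) (by norm_num)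
      (Or.inr (tail_six_heavy_sq38T_36 (p + 36) (by omega))) hR hn hfree (level_six_poly_heavy_sq38T_36 p hp)
  · exact c025_core_six_heavy_cell_sq38t M p 37 26 1 1 39 0 1 1999 1000 39
      (by norm_num) (by norm_num) (by norm_num) (by norm_num) (by norm_num) (by norm_num) (by norm_num)
      (by norm_num [cnull]) (by norm_num [cnull]) (Or.inr ⟨by norm_num, by norm_num⟩) (Or.inr (Or.inr (by norm_num))) (Or.inr rfl) (by norm_num) (by norm_num) (by norm_num)
      (Or.inr (tail_six_heavy_sq38T_37 (p + 37) (by omega))) hR hn hfree (level_six_poly_heavy_sq38T_37 p hp)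
  · exact c025_core_six_heavy_cell_sq38t M p 38 27 1 1 39 0 1 1832 1000 39
      (by norm_num) (by norm_num) (by norm_num) (by norm_num) (by norm_num) (by norm_num) (by norm_num)
      (by norm_num [cnull]) (by norm_num [cnull]) (Or.inr ⟨by norm_num, by norm_num⟩) (Or.inr (Or.inr (by norm_num))) (Or.inr rfl) (by norm_num) (by norm_num) (by norm_num)
      (Or.inr (tail_six_heavy_sq38T_38 (p + 38) (by omega))) hR hn hfree (level_six_poly_heavy_sq38T_38 p hp)
  · exact c025_core_six_heavy_cell_sq38t M p 39 27 1 1 39 0 1 1694 1000 39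
      (by norm_num) (by norm_num) (by norm_num) (by norm_num) (by norm_num) (by norm_num) (by norm_num)
      (by norm_num [cnull]) (by norm_num [cnull]) (Or.inr ⟨by norm_num, by norm_num⟩) (Or.inr (Or.inr (by norm_num))) (Or.inr rfl) (by norm_num) (by norm_num) (by norm_num)
      (Or.inr (tail_six_heavy_sq38T_39 (p + 39) (by omega))) hR hn hfree (level_six_poly_heavy_sq38T_39 p hp)
  · exact c025_core_six_heavy_cell_sq38t M p 40 28 1 1 39 0 1 1580 1000 39
      (by norm_num) (by norm_num) (by norm_num) (by norm_num) (by norm_num) (by norm_num) (by norm_num)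
      (by norm_num [cnull]) (by norm_num [cnull]) (Or.inr ⟨by norm_num, by norm_num⟩) (Or.inr (Or.inr (by norm_num))) (Or.inr rfl) (by norm_num) (by norm_num) (by norm_num)
      (Or.inr (tail_six_heavy_sq38T_40 (p + 40) (by omega))) hR hn hfree (level_six_poly_heavy_sq38T_40 p hp)
  · exact c025_core_six_heavy_cell_sq38t M p 41 28 1 1 39 0 1 1484 1000 39
      (by norm_num) (by norm_num) (by norm_num) (by norm_num) (by norm_num) (by norm_num) (by norm_num)
      (by norm_num [cnull]) (by norm_num [cnull]) (Or.inr ⟨by norm_num, by norm_num⟩) (Or.inr (Or.inr (by norm_num))) (Or.inr rfl) (by norm_num) (by norm_num) (by norm_num)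
      (Or.inr (tail_six_heavy_sq38T_41 (p + 41) (by omega))) hR hn hfree (level_six_poly_heavy_sq38T_41 p hp)
  · exact c025_core_six_heavy_cell_sq38t M p 42 29 1 1 39 0 1 1404 1000 39
      (by norm_num) (by norm_num) (by norm_num) (by norm_num) (by norm_num) (by norm_num) (by norm_num)
      (by norm_num [cnull]) (by norm_num [cnull]) (Or.inr ⟨by norm_num, by norm_num⟩) (Or.inr (Or.inr (by norm_num))) (Or.inr rfl) (by norm_num) (by norm_num) (by norm_num)
      (Or.inr (tail_six_heavy_sq38T_42 (p + 42) (by omega))) hR hn hfree (level_six_poly_heavy_sq38T_42 p hp)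
  · exact c025_core_six_heavy_cell_sq38t M p 43 29 1 1 39 0 1 1338 1000 39
      (by norm_num) (by norm_num) (by norm_num) (by norm_num) (by norm_num) (by norm_num) (by norm_num)
      (by norm_num [cnull]) (by norm_num [cnull]) (Or.inr ⟨by norm_num, by norm_num⟩) (Or.inr (Or.inr (by norm_num))) (Or.inr rfl) (by norm_num) (by norm_num) (by norm_num)
      (Or.inr (tail_six_heavy_sq38T_43 (p + 43) (by omega))) hR hn hfree (level_six_poly_heavy_sq38T_43 p hp)
  · exact c025_core_six_heavy_cell_sq38t M p 44 30 1 1 39 0 1 1281 1000 39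
      (by norm_num) (by norm_num) (by norm_num) (by norm_num) (by norm_num) (by norm_num) (by norm_num)
      (by norm_num [cnull]) (by norm_num [cnull]) (Or.inr ⟨by norm_num, by norm_num⟩) (Or.inr (Or.inr (by norm_num))) (Or.inr rfl) (by norm_num) (by norm_num) (by norm_num)
      (Or.inr (tail_six_heavy_sq38T_44 (p + 44) (by omega))) hR hn hfree (level_six_poly_heavy_sq38T_44 p hp)
  · exact c025_core_six_heavy_cell_sq38t M p 45 30 1 1 39 0 1 1234 1000 39
      (by norm_num) (by norm_num) (by norm_num) (by norm_num) (by norm_num) (by norm_num) (by norm_num)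
      (by norm_num [cnull]) (by norm_num [cnull]) (Or.inr ⟨by norm_num, by norm_num⟩) (Or.inr (Or.inr (by norm_num))) (Or.inr rfl) (by norm_num) (by norm_num) (by norm_num)
      (Or.inr (tail_six_heavy_sq38T_45 (p + 45) (by omega))) hR hn hfree (level_six_poly_heavy_sq38T_45 p hp)
  · exact c025_core_six_heavy_cell_sq38t M p 46 31 1 1 39 0 1 1194 1000 39
      (by norm_num) (by norm_num) (by norm_num) (by norm_num) (by norm_num) (by norm_num) (by norm_num)
      (by norm_num [cnull]) (by norm_num [cnull]) (Or.inr ⟨by norm_num, by norm_num⟩) (Or.inr (Or.inr (by norm_num))) (Or.inr rfl) (by norm_num) (by norm_num) (by norm_num)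
      (Or.inr (tail_six_heavy_sq38T_46 (p + 46) (by omega))) hR hn hfree (level_six_poly_heavy_sq38T_46 p hp)
  · exact c025_core_six_heavy_cell_sq38t M p 47 31 1 1 39 0 1 1161 1000 39
      (by norm_num) (by norm_num) (by norm_num) (by norm_num) (by norm_num) (by norm_num) (by norm_num)
      (by norm_num [cnull]) (by norm_num [cnull]) (Or.inr ⟨by norm_num, by norm_num⟩) (Or.inr (Or.inr (by norm_num))) (Or.inr rfl) (by norm_num) (by norm_num) (by norm_num)
      (Or.inr (tail_six_heavy_sq38T_47 (p + 47) (by omega))) hR hn hfree (level_six_poly_heavy_sq38T_47 p hp)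
  · exact c025_core_six_heavy_cell_sq38t M p 48 32 1 1 39 0 1 1133 1000 39
      (by norm_num) (by norm_num) (by norm_num) (by norm_num) (by norm_num) (by norm_num) (by norm_num)
      (by norm_num [cnull]) (by norm_num [cnull]) (Or.inr ⟨by norm_num, by norm_num⟩) (Or.inr (Or.inr (by norm_num))) (Or.inr rfl) (by norm_num) (by norm_num) (by norm_num)
      (Or.inr (tail_six_heavy_sq38T_48 (p + 48) (by omega))) hR hn hfree (level_six_poly_heavy_sq38T_48 p hp)
  · exact c025_core_six_heavy_cell_sq38t M p 49 32 1 1 39 0 1 1109 1000 39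
      (by norm_num) (by norm_num) (by norm_num) (by norm_num) (by norm_num) (by norm_num) (by norm_num)
      (by norm_num [cnull]) (by norm_num [cnull]) (Or.inr ⟨by norm_num, by norm_num⟩) (Or.inr (Or.inr (by norm_num))) (Or.inr rfl) (by norm_num) (by norm_num) (by norm_num)
      (Or.inr (tail_six_heavy_sq38T_49 (p + 49) (by omega))) hR hn hfree (level_six_poly_heavy_sq38T_49 p hp)
  · exact c025_core_six_heavy_cell_sq38t M p 50 33 1 1 39 0 1 1090 1000 39
      (by norm_num) (by norm_num) (by norm_num) (by norm_num) (by norm_num) (by norm_num) (by norm_num)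
      (by norm_num [cnull]) (by norm_num [cnull]) (Or.inr ⟨by norm_num, by norm_num⟩) (Or.inr (Or.inr (by norm_num))) (Or.inr rfl) (by norm_num) (by norm_num) (by norm_num)
      (Or.inr (tail_six_heavy_sq38T_50 (p + 50) (by omega))) hR hn hfree (level_six_poly_heavy_sq38T_50 p hp)

/-- **THEOREM C₆ ON THE FLAT BOUNDS `39 / 19`, LEMMAS T⁺⁺ AND T4⁺, THE FLAT-COUNT TAIL AND THE UNIQUE HEAVY FLAT, GIVEN LEVEL `5`**:
level `5` for all `p ≥ 37` implies level `6` for all `p ≥ 38`. -/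
theorem c025_six_of_five_heavy_sq38t (h5 : ∀ (M : Matroid α) [M.Finite] (p : ℕ), 37 ≤ p → RLS M p 5) :
    ∀ (M : Matroid α) [M.Finite] (p : ℕ), 38 ≤ p → RLS M p 6 := by
  intro M _ p hp
  rcases Nat.lt_or_ge p 39 with hlt | hge
  · have hP : p = 38 := by omega
    subst hP
    refine rls_six_at_of_core 38 (by norm_num) (fun M _ => h5 M 37 (by norm_num)) ?_ M
    intro M _ d hd hR hn hfree
    rcases Nat.lt_or_ge d 51 with hd50 | hd51
    · exact c025_core_six_bounded_corank_heavy_sq38t M 38 d (by norm_num) hd (by omega) hR hn hfree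
    · exact c025_core_six_thirtynine_thirtyeight' M 38 (by norm_num) hR (by omega) hfree
  · refine rls_succ_large (α := α) 5 6 38 ?_ ?_ ?_ M p hge (by omega)
    · intro M' _ p' hP _
      exact h5 M' p' (by omega)
    · intro M' _ p' _ hn _
      rcases Nat.lt_or_ge M'.E.ncard (p' + 6) with h | h
      · exact RLS_of_ncard_lt M' h
      · exact RLS_of_ncard_eq M' (by omega)
    · intro M' _ p' hP hR hbig _ hfree
      rcases Nat.lt_or_ge M'.E.ncard (p' + 51) with h | h
      · exact c025_core_six_bounded_corank_heavy_sq38t M' p' (M'.E.ncard - p') hP (by omega) (by omega) hR (by omega) hfree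
      · exact c025_core_six_thirtynine_thirtyeight' M' p' (by omega) hR (by omega) hfree

/-- **C-025 AT LEVEL `6` FOR EVERY `p ≥ 38`, EVERY FINITE MATROID, UNCONDITIONAL** — `c025_six_of_five_heavy_sq38t` on
p7's level-`5` row `c025_five_large_part33 (33 ≤ p)`. -/
theorem c025_six_large_thirty_eight (M : Matroid α) [M.Finite] (p : ℕ) (hp : 38 ≤ p) : RLS M p 6 :=
  c025_six_of_five_heavy_sq38t (fun M _ p hp => c025_five_large_part33 M p (by omega)) M p hp

/-- The same in the vocabulary of `C025`: the level-`6` frontier of the counting route is every `p ≥ 38`. -/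
theorem c025_six_large_thirty_eight' (M : Matroid α) [M.Finite] (p : ℕ) (hp : 38 ≤ p) :
    phiK p 6 * ({A : Set α | A ⊆ M.E ∧ M.eRk A = (p : ℕ∞) ∧ M.eRk (M.E \ A) = (6 : ℕ∞)}.ncard : ℚ) ≤
      ({A : Set α | A ⊆ M.E ∧ (6 : ℕ∞) < M.eRk A ∧ M.eRk A < (p : ℕ∞)}.ncard : ℚ) :=
  c025_six_large_thirty_eight M p hp

end ThmN

end PercRepro
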